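import Literature.MathematicalPhysics.QuantumFieldTheory.Balaban1983to89.B3Op116MajorantStepBox
import Literature.MathematicalPhysics.QuantumFieldTheory.Balaban1983to89.B3Op116FaceSumsSubOne
import Literature.MathematicalPhysics.QuantumFieldTheory.Balaban1983to89.B3Op116CollarRowReduce

/-!
# `Balaban1983to89.B3Op116MajorantStepBoxFar` — T. Bałaban, *(Higgs)₂,₃ quantum fields in a finite volume. III. Renormalization*,
# Commun. Math. Phys. **88** (1983) 411–445 [Balaban1983Higgs3], (1.16) p. 414 / (2.5)–(2.6) p. 424 / (2.10)–(2.11) p. 426 / p. 433: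
# **THE BOX STEP WITH A PENDING SHEET OF EXPONENT ONE, ANCHORED AT A SOURCE ONE TOP BLOCK INSIDE `□`** — the three-slot row of
# `B3Op116MajorantStepBox` for a field of value exponent `1 < a_v ≤ 2` whose sheet (exponent `a_v − 1 ≤ 1`) is anchored at a source `x′` of
# height `≥ θL^k` above every face level: the composed face convolution is `B3Op116FaceSumsSubOne.face_conv_majorant_le_one_margin_le` READ
# SYMMETRICALLY (margin at the source, not at the row point); output exponent `a_K + a_v − 1`, rate `δ/(4L)`, constants uniform in `k` — the
# digestion step (M0) of the mixed/dipole member `hM` of (2.5) for (1.16) on a box without the support clause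

statement-level skeleton of published theorems with citation tags; proofs where landed; nothing here is a claim about the Yang–Mills mass gap

PDF held: `paper:balaban1983-higgs-2-3-quantum-fields-finite-volume` (journal page = PDF page + 410; p. 414 = `p0004.txt`, p. 424 = `p0014.txt`,
p. 426 = `p0016.txt`, p. 433 = `p0023.txt`); `paper:balaban1982-cmp85-higgs23-i` (p. 615 = `p0013.txt`, p. 610 = `p0008.txt`).

CITATION HEADER (lean-in-tree rule).  T. Bałaban, CMP **88** (1983) 411–445 [Balaban1983Higgs3]: (1.16) p. 414, (2.5)/(2.6) p. 424, (2.10)–(2.11)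
p. 426, p. 433; part I, CMP **85** (1982) 603–636 [Balaban1982Higgs1]: (3.16) p. 615 (the sources of `V_k(A,B)`), (2.20) p. 610, (1.4) p. 604.
Cell `lit-balaban` (HOME `run/shared/lean/pub/lit-balaban/`), Phase-2 proof seat **p35** gen 28 (literature-prover-lit-balaban-p35-g28-0; free-target
protocol G.5-34(d), TAKING HOME/STATUS.md 2026-08-24T15:44Z, cc r15 / p40).  SKELETON rows **B3.Eq1.16** / **B3.Eq2.5** / **B3.Txt@433** / **B3.Prop1**
(owner r15) — LOCATED ENGINE FILE, no head claim: file M0 of the mixed member (F5-M) of the «(2.5) for (1.16) on a cell-product box `□` without the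
support clause» programme (GAPS.md G-B3-16.A1, route γ′; p35 `DESIGN-FILE4.md` §14 (d), §18, **§19**).  USED BY NAME, never restated: p35's
`B3Op116MajorantStep.{maj, convK, stepC, row_step_le, maj_comm, maj_exponent_reduce}`, `B3Op116MajorantStepBox.{faceK, pair_face_le}`,
`B3Op116FaceSumsSubOne.face_conv_majorant_le_one_margin_le`, `B3Op116CollarRowReduce.{kapF, collar_row_reduce, col_le_maj_all, dcol_le_maj_all,
propagatorK_srcV_apply_eq_zero_of_not_mem, proj_propagatorK_single_eq_zero, covDerivAt_propagatorK_single_eq_zero}`, p33's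
`B3Op116MajorantConvolution.conv_majorant_le`, p40's located Leibniz row (through `collar_row_reduce`), r14's `B3Op116SourceForm.{srcV, covDerivAt}`.

WHAT IS PRINTED (verbatim).  p. 414 [PDF 4]: *"for n, n′ sufficiently large, a kernel of the operator (1.16) is a sufficiently regular function of
both variables. More exactly the Hölder norms of the covariant derivatives of this kernel, the norms defined for example in the inequalities (I.2.24)
and (I.2.25) of Proposition I.2.1, are exponentially decaying with the distance of the arguments and are uniformly bounded by
O(1)(e(L^kε)^{1−α})^{n+n′} … This estimate follows easily from the properties of the propagators G_k(Ω, A) proved in the next paper."*  p. 426 (2.10)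
[PDF 16]: *"|G^η_{(j)}(Ω, B̃; x, x′)| ≤ O(1)(L^jη)^{−d+2}e^{−δ₁(L^jη)^{−1}|x−x′|}, (2.10) and if the propagator is differentiated, then for each
differentiation, there is an additional factor (L^jη)^{−1} on the right side."*  p. 433 [PDF 23]: *"we take a cube □ of size 3r(L^kε) and with □₁ in
the center. We assume that □₁, □ are sums of big blocks of the unit lattice."* — the (I.2.25)/(1.32) member with one covariant derivative in EACH
variable (a dipole source read through a row derivative) is evaluated with both arguments in `□₁`, one collar `r(L^kε) ≫ L^kε` inside `□`.

WHY THIS FILE (DESIGN-FILE4 §19).  The dipole-seeded chain `(1.16)^□_{n,n′}dip^B_{x′}Y` starts with a field of value exponent `1`; after the one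
special (two-scale) step its image has value exponent `2`, regular derivative exponent `1`, and — on a box, where the Leibniz identity A′ restricted
to the bonds of `□` leaves face legs — a PENDING SHEET of exponent `1` (not `> 1`): `B3Op116MajorantStepBox.row_step_box_le` cannot digest it
(`sum_majorant_face_pending_le` needs the sheet exponent `> 1`: the pairs with the sheet's scale finer than the column's do not sum).  They DO sum
when the sheet's anchor `x′` lies one top block inside `□` (every face site is `≥ θL^k` away from `x′`: the decay `e^{−δθL^{k−j}}` of the finer
scale replaces the missing power) — which is exactly the height hypothesis of `face_conv_majorant_le_one_margin_le` placed at the OTHER anchor.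

WHAT THIS FILE PROVES (pure bookkeeping on `T_ε` in §§1–4; the located step on a `k`-block union `Ω` in §5).
* §1 `faceKfar` / `pendKfar`: the constants (the one-margin face constant with the margin on the sheet side; composed with `convK(p,1)`), `≥ 0`.
* §2 **`face_conv_maj_le_far`**: `Σ_{u∈F}𝔪(c₁,r;δ)(x,u)·𝔪(c₂,s;δ)(u,y) ≤ 𝔪(c₁c₂·K_far(δ,s,r,θ), r+s−1; δ/2)(x,y)` for `r > 1`, `0 < s ≤ 1`, `F ⊆ {u_ν = c}`
  and `y` of height `≥ θL^k` above the level `c` (the symmetric reading); **`sum_maj_face_pending_le_far`**: the composed form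
  `Σ_b 𝔪(c₀,p)(z,b)·[Σ_{u∈F}𝔪(c₁,1)(b,u)S(u)] ≤ 𝔪(c₀c₁c_S·K_P^far, p+s; δ/4)(z,y)` for `S ≤ 𝔪(c_S,s)(·,y)`, `0 < s ≤ 1`, `p > 0`, `y` far.
* §3 `pair_pend_site_le_far` / `pair_pend_src_le_far` / `pair_pend_tgt_le_far`: the pending part of the derivative state against the row kernel,
  `1 < a_v ≤ 2`, source far from every face: `≤ d·n_F·𝔪(c_Kc₁c_S·K_P^far, a_K + (a_v−1); δ/4)(p,x′)`.
* §4 `stepBoxCfar` / `stepBoxVCfar` and **`row_step_box_deriv_le_far`** / **`row_step_box_le_far`**: the three-slot rows of `B3Op116MajorantStepBox` for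
  `1 < a_v ≤ 2` with a far-anchored sheet — SAME output exponent `a_K + a_v − 1` and rate `δ/(4L)` as the torus step.
* §5 **`step_fields_box_far`**: the twin of `B3Op116DKernelRegularBox.step_fields_box` at value exponent `1 < a_v ≤ 2` WITH an incoming sheet, for a
  source `x′` of height `≥ θL^k` above every face level: `w⁺ = G_k(Ω,X)V_k^Ω(A,B)w` vanishes off `Ω`, its values / derivatives at the bonds `⊂ Ω` /
  new sheet `κ_F‖w‖` have the standard three-component shape at exponent `a_v + 1` — after this one step the standard induction
  (`B3Op116DKernelRegularBox.step_fields_box`, sheet exponent `> 1`) runs.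
HONEST SCOPE.  Abstract kernels in §§1–4; in §5 the (2.10) dictionary of `G_k(Ω,X)` ON `Ω`, the regularity of `A`, the face family and the height of
`x′` are HYPOTHESES; nothing of (1.16)/(2.5) is asserted (the dipole seed itself — M1 `B3Op116MixedSeedBox` — and the assembly of `hM` — M2 — are the
sequel).  The «symmetric reading» of §2 is the landed statement of `B3Op116FaceSumsSubOne.face_conv_majorant_le_one_margin_le` (p370170) applied
with its two anchors exchanged through `B3Op116MajorantStep.maj_comm` — NO new hypothesis and no new face estimate; NEW WRITING here = the
bookkeeping twins §§1–5 of `B3Op116MajorantStepBox` §§1–3 (p366616) and of `B3Op116DKernelRegularBox.step_fields_box` (p370293) below their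
threshold `a_v > 2`; p40's torus road for the mixed member (`B3Op116MixedKernelRegularTorus.GB_srcV_GB_eq`, `B3Op116MixedSeed.inner_W_dip_apply`,
`maj_exponent_reduce`) is NOT used in this file (it enters in M2).  Route γ′ is the cell's reading of print's one-piece expansion on `□` (G-B3-16.A1: print does not spell the face bookkeeping out).  Four
`def`s (`faceKfar`, `pendKfar`, `stepBoxCfar`, `stepBoxVCfar`: displayed real constants); no `def … : Prop`, no new named fact, no `sorry`; axioms
standard.  Value = located engine of a by-reference step of B3 — NOT summit progress and nothing about the mass gap.
-/

noncomputable section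

open scoped BigOperators

namespace Literature.MathematicalPhysics.QuantumFieldTheory.Balaban1983to89.B3Op116MajorantStepBoxFar

open HiggsLattice (ChargeData ScalarField covDeriv)
open HiggsCovariance (propagatorK E)
open HiggsCovariancePos (Inside sum_site_dir)
open HiggsAveraging (blockK blockIter)
open B1Eq230FluctCov (Ix cb)
open B1Ineq234Concrete (nCol)
open B3Op116SourceForm (srcV covDerivAt)
open B3Op116MajorantStep (maj maj_nonneg maj_rate_mono maj_const_mono maj_add mul_maj maj_comm maj_shift_right convK convK_nonneg
  stepC stepC_nonneg row_step_le)
open B3Op116MajorantStepBox (faceK faceK_nonneg pair_face_le)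
open B3Op116MajorantConvolution (conv_majorant_le)
open B3Op116FaceSumsSubOne (face_conv_majorant_le_one_margin_le)
open B3Op116CollarSources (inB exB enB mem_inB)
open B3Op116DKernelRegularTorus (kap4 kap4_nonneg)
open B3Op116CollarRowReduce (kapF kapF_nonneg collar_row_reduce propagatorK_srcV_apply_eq_zero_of_not_mem proj_propagatorK_single_eq_zero
  covDerivAt_propagatorK_single_eq_zero col_le_maj_all dcol_le_maj_all)

variable {P : HiggsLattice.Params} {N : ℕ}

/-! ## §1 The constants -/

section Constants

/-- The one-margin face constant with the margin on the SHEET side: `K_far(δ,s,r,θ) = (8d/δ)^{d−1}(ε^{d−1})^{−1}·(θ^{s−1}(1+4d/δ)r₁/(1−r₁) +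
L^{r−1}/(L^{r−1}−1))`, `r₁ = e^{−(δ/2)θ(L−1)/(2d)}` — the constant of `B3Op116FaceSumsSubOne.face_conv_majorant_le_one_margin_le` with the roles of the
two exponents exchanged (`s ≤ 1` the sheet's, `r > 1` the column's). [cite: Balaban1983Higgs3, (2.6) p.424, (2.10)–(2.11) p.426, p.433] -/
def faceKfar (P : HiggsLattice.Params) (δ s r θ : ℝ) : ℝ :=
  (8 * P.d / δ) ^ (P.d - 1) * (P.mesh 0 ^ (P.d - 1))⁻¹ *
    (θ ^ (s - 1) * ((1 + 4 * P.d / δ) *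
        (Real.exp (-(δ / 2 * θ * ((P.L : ℝ) - 1) / (2 * P.d))) / (1 - Real.exp (-(δ / 2 * θ * ((P.L : ℝ) - 1) / (2 * P.d))))))
      + (P.L : ℝ) ^ (r - 1) / ((P.L : ℝ) ^ (r - 1) - 1))

/-- `K_far ≥ 0` for `δ, θ > 0`, `r > 1`, `L > 1`. [cite: Balaban1983Higgs3, (2.10) p.426] -/
theorem faceKfar_nonneg (hL : 1 < P.L) {δ s r θ : ℝ} (hδ : 0 < δ) (hr : 1 < r) (hθ : 0 < θ) : 0 ≤ faceKfar P δ s r θ := by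
  have hL1 : (1 : ℝ) < (P.L : ℝ) := by exact_mod_cast hL
  have hd0 : (0 : ℝ) < P.d := by exact_mod_cast P.hd
  have h1 : 0 < (P.L : ℝ) ^ (r - 1) - 1 := by have := Real.one_lt_rpow hL1 (by linarith : 0 < r - 1); linarith
  have h2 : 0 ≤ (P.L : ℝ) ^ (r - 1) := Real.rpow_nonneg (by positivity) _
  have hq : 0 < 1 - Real.exp (-(δ / 2 * θ * ((P.L : ℝ) - 1) / (2 * P.d))) := by
    have hpos : 0 < δ / 2 * θ * ((P.L : ℝ) - 1) / (2 * P.d) := by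
      have hL' : 0 < (P.L : ℝ) - 1 := by linarith
      positivity
    have : Real.exp (-(δ / 2 * θ * ((P.L : ℝ) - 1) / (2 * P.d))) < 1 := Real.exp_lt_one_iff.mpr (by linarith)
    linarith
  have hΛ : 0 ≤ (1 + 4 * P.d / δ) *
      (Real.exp (-(δ / 2 * θ * ((P.L : ℝ) - 1) / (2 * P.d))) / (1 - Real.exp (-(δ / 2 * θ * ((P.L : ℝ) - 1) / (2 * P.d))))) :=
    mul_nonneg (by positivity) (div_nonneg (Real.exp_nonneg _) hq.le)
  have hG : 0 ≤ (P.L : ℝ) ^ (r - 1) / ((P.L : ℝ) ^ (r - 1) - 1) := div_nonneg h2 h1.le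
  have hθs : 0 ≤ θ ^ (s - 1) := Real.rpow_nonneg hθ.le _
  have hε := P.mesh_pos 0
  unfold faceKfar
  exact mul_nonneg (mul_nonneg (by positivity) (inv_nonneg.mpr (pow_nonneg hε.le _))) (add_nonneg (mul_nonneg hθs hΛ) hG)

/-- The constant of the composed («pending-sheet») step with a far-anchored sheet: `K_P^far(p,s;δ,θ) = K_conv(p,1;δ)·K_far(δ/2,s,p+1,θ)`.
[cite: Balaban1983Higgs3, (2.6) p.424, (2.10) p.426] -/
def pendKfar (P : HiggsLattice.Params) (N : ℕ) (δ p s θ : ℝ) : ℝ :=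
  convK P N δ p 1 * faceKfar P (δ / 2) s (p + 1) θ

/-- `K_P^far ≥ 0` for `p > 0`, `δ, θ > 0`. [cite: Balaban1983Higgs3, (2.10) p.426] -/
theorem pendKfar_nonneg (hL : 1 < P.L) {δ p s θ : ℝ} (hδ : 0 < δ) (hp : 0 < p) (hθ : 0 < θ) : 0 ≤ pendKfar P N δ p s θ :=
  mul_nonneg (convK_nonneg hL hδ hp one_pos) (faceKfar_nonneg hL (half_pos hδ) (by linarith) hθ)

end Constants

/-! ## §2 The face convolution with the margin at the sheet's anchor, and its composed form -/

section Face

/-- **THE FACE CONVOLUTION WITH THE MARGIN ON THE SECOND ANCHOR**: for `r > 1`, `0 < s ≤ 1`, `0 < δ ≤ 1`, `L > 1`, `F ⊆ {u_ν = c}`, `θ > 0` and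
`y` with `θL^k ≤ min{(y_ν − c) mod, (c − y_ν) mod}`:
`Σ_{u∈F}𝔪(c₁,r;δ)(x,u)·𝔪(c₂,s;δ)(u,y) ≤ 𝔪(c₁c₂K_far(δ,s,r,θ), r+s−1; δ/2)(x,y)` — `face_conv_majorant_le_one_margin_le` read through `maj_comm`
(the pairs whose exponent-`s` factor is the finer carry the height decay at `y`; the others are geometric since `r − 1 > 0`); NO condition at `x`.
[cite: Balaban1983Higgs3, (1.16) p.414, (2.6) p.424, (2.10)–(2.11) p.426, p.433] -/
theorem face_conv_maj_le_far (hL : 1 < P.L) {k : ℕ} {δ : ℝ} (hδ : 0 < δ) (hδ1 : δ ≤ 1) {r s c₁ c₂ θ : ℝ}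
    (hr : 1 < r) (hs0 : 0 < s) (hs1 : s ≤ 1) (hc₁ : 0 ≤ c₁) (hc₂ : 0 ≤ c₂) (hθ : 0 < θ)
    {F : Finset (HiggsLattice.Site P 0)} {ν : Fin P.d} {c : ZMod (P.sitesPerDir 0 ν)} (hF : ∀ u ∈ F, u ν = c)
    (x y : HiggsLattice.Site P 0) (hh : θ * (P.L : ℝ) ^ k ≤ ((min (y ν - c).val (c - y ν).val : ℕ) : ℝ)) :
    ∑ u ∈ F, maj P k c₁ r δ x u * maj P k c₂ s δ u y ≤ maj P k (c₁ * c₂ * faceKfar P δ s r θ) (r + s - 1) (δ / 2) x y := by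
  have h := face_conv_majorant_le_one_margin_le (P := P) hL hδ hδ1 hs0 hs1 hr hc₂ hc₁ hθ hF y x hh
  have hswap : ∑ u ∈ F, maj P k c₁ r δ x u * maj P k c₂ s δ u y = ∑ u ∈ F, maj P k c₂ s δ y u * maj P k c₁ r δ u x := by
    refine Finset.sum_congr rfl fun u _ => ?_
    rw [maj_comm k c₁ r δ x u, maj_comm k c₂ s δ u y, mul_comm]
  rw [hswap, maj_comm k _ _ _ x y]
  rw [show s + r - 1 - (P.d : ℝ) = r + s - 1 - (P.d : ℝ) by ring] at h
  unfold maj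
  refine h.trans (le_of_eq (Finset.sum_congr rfl fun j _ => ?_))
  unfold faceKfar
  ring

/-- **THE PENDING-SHEET STEP WITH A FAR-ANCHORED SHEET.**  A single layer on a face `F ⊆ {u_ν = c}` with density `S ≤ 𝔪(c₂,s;δ)(·,y)`, `0 < s ≤ 1`,
anchored at a point `y` of height `≥ θL^k` above the face level, read through a column `𝔪(c₁,1;δ)(b,·)` of exponent ONE and THEN through any
kernel `𝔪(c₀,p;δ)(z,b)` of exponent `p > 0` summed over all sites `b`, is a majorant of exponent `p + s` at rate `δ/4`:
`Σ_b 𝔪(c₀,p;δ)(z,b)·[Σ_{u∈F}𝔪(c₁,1;δ)(b,u)·S(u)] ≤ 𝔪(c₀c₁c₂·K_P^far(p,s;δ,θ), p+s; δ/4)(z,y)` — Fubini, p33's `conv_majorant_le` with exponents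
`(p, 1)` (output `p + 1 > 1`), then `face_conv_maj_le_far` with exponents `(p+1, s)`. [cite: Balaban1983Higgs3, (1.16) p.414, (2.6) p.424, (2.10) p.426, p.433] -/
theorem sum_maj_face_pending_le_far (hL : 1 < P.L) {k : ℕ} {δ : ℝ} (hδ : 0 < δ) (hδ1 : δ ≤ 1) {p s c₀ c₁ c₂ θ : ℝ}
    (hp : 0 < p) (hs0 : 0 < s) (hs1 : s ≤ 1) (hc₀ : 0 ≤ c₀) (hc₁ : 0 ≤ c₁) (hc₂ : 0 ≤ c₂) (hθ : 0 < θ) (i₀ : Ix N)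
    {F : Finset (HiggsLattice.Site P 0)} {ν : Fin P.d} {c : ZMod (P.sitesPerDir 0 ν)} (hF : ∀ u ∈ F, u ν = c)
    (z y : HiggsLattice.Site P 0) (hh : θ * (P.L : ℝ) ^ k ≤ ((min (y ν - c).val (c - y ν).val : ℕ) : ℝ))
    (S : HiggsLattice.Site P 0 → ℝ) (hS0 : ∀ u ∈ F, 0 ≤ S u) (hS : ∀ u ∈ F, S u ≤ maj P k c₂ s δ u y) :
    ∑ b : HiggsLattice.Site P 0, maj P k c₀ p δ z b * ∑ u ∈ F, maj P k c₁ 1 δ b u * S u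
      ≤ maj P k (c₀ * c₁ * c₂ * pendKfar P N δ p s θ) (p + s) (δ / 2 / 2) z y := by
  have hδ2 : 0 < δ / 2 := by linarith
  have hδ21 : δ / 2 ≤ 1 := by linarith
  have hC₁0 : 0 ≤ c₀ * c₁ * convK P N δ p 1 := mul_nonneg (mul_nonneg hc₀ hc₁) (convK_nonneg hL hδ hp one_pos)
  -- the composed column `Σ_b 𝔪(p)(z,b)𝔪(1)(b,u) ≤ 𝔪(c₀c₁K_conv(p,1), p+1; δ/2)(z,u)`
  have hcomp : ∀ u, ∑ b : HiggsLattice.Site P 0, maj P k c₀ p δ z b * maj P k c₁ 1 δ b u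
      ≤ maj P k (c₀ * c₁ * convK P N δ p 1) (p + 1) (δ / 2) z u := fun u => by
    unfold maj convK
    exact conv_majorant_le hL hδ hδ1 hp one_pos hc₀ hc₁ i₀ z u
  have hS2 : ∀ u ∈ F, S u ≤ maj P k c₂ s (δ / 2) u y := fun u hu => (hS u hu).trans (maj_rate_mono hc₂ (by linarith) u y)
  -- Fubini
  have hfub : ∑ b : HiggsLattice.Site P 0, maj P k c₀ p δ z b * ∑ u ∈ F, maj P k c₁ 1 δ b u * S u
      = ∑ u ∈ F, (∑ b : HiggsLattice.Site P 0, maj P k c₀ p δ z b * maj P k c₁ 1 δ b u) * S u := by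
    calc ∑ b : HiggsLattice.Site P 0, maj P k c₀ p δ z b * ∑ u ∈ F, maj P k c₁ 1 δ b u * S u
        = ∑ b : HiggsLattice.Site P 0, ∑ u ∈ F, maj P k c₀ p δ z b * maj P k c₁ 1 δ b u * S u := by
          refine Finset.sum_congr rfl fun b _ => ?_
          rw [Finset.mul_sum]
          exact Finset.sum_congr rfl fun u _ => by ring
      _ = ∑ u ∈ F, ∑ b : HiggsLattice.Site P 0, maj P k c₀ p δ z b * maj P k c₁ 1 δ b u * S u := Finset.sum_comm
      _ = _ := Finset.sum_congr rfl fun u _ => by rw [Finset.sum_mul]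
  rw [hfub]
  have hp1 : 1 < p + 1 := by linarith
  calc ∑ u ∈ F, (∑ b : HiggsLattice.Site P 0, maj P k c₀ p δ z b * maj P k c₁ 1 δ b u) * S u
      ≤ ∑ u ∈ F, maj P k (c₀ * c₁ * convK P N δ p 1) (p + 1) (δ / 2) z u * maj P k c₂ s (δ / 2) u y :=
        Finset.sum_le_sum fun u hu => mul_le_mul (hcomp u) (hS2 u hu) (hS0 u hu)
          ((Finset.sum_nonneg fun b _ => mul_nonneg (maj_nonneg hc₀ z b) (maj_nonneg hc₁ b u)).trans (hcomp u))
    _ ≤ maj P k (c₀ * c₁ * convK P N δ p 1 * c₂ * faceKfar P (δ / 2) s (p + 1) θ) (p + 1 + s - 1) (δ / 2 / 2) z y :=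
        face_conv_maj_le_far hL hδ2 hδ21 hp1 hs0 hs1 hC₁0 hc₂ hθ hF z y hh
    _ = _ := by
        rw [show p + 1 + s - 1 = p + s by ring]
        unfold pendKfar
        congr 1
        ring

end Face

/-! ## §3 The pending part of the derivative state against the row kernel, source far from every face -/

section Pairings

variable (hL : 1 < P.L) {k : ℕ} {δ : ℝ} (hδ : 0 < δ) (hδ1 : δ ≤ 1)
  {aK av cK cS c₁ θ : ℝ} (hcK : 0 ≤ cK) (hcS : 0 ≤ cS) (hc₁ : 0 ≤ c₁) (hθ : 0 < θ)
  (i₀ : Ix N) (p x' : HiggsLattice.Site P 0)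
  {nF : ℕ} (F : Fin nF → Finset (HiggsLattice.Site P 0)) (ν : Fin nF → Fin P.d)
  (c : (i : Fin nF) → ZMod (P.sitesPerDir 0 (ν i))) (hF : ∀ i, ∀ u ∈ F i, u (ν i) = c i)
  (hfar : ∀ i, θ * (P.L : ℝ) ^ k ≤ ((min (x' (ν i) - c i).val (c i - x' (ν i)).val : ℕ) : ℝ))
  (K : HiggsLattice.Site P 0 → ℝ) (hK : ∀ y, K y ≤ maj P k cK aK δ p y)
  (S : Fin nF → HiggsLattice.Site P 0 → ℝ) (hS0 : ∀ i, ∀ u ∈ F i, 0 ≤ S i u)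
  (hS : ∀ i, ∀ u ∈ F i, S i u ≤ maj P k cS (av - 1) δ u x')
include hL hδ hδ1 hcK hcS hc₁ hθ i₀ hF hfar hK hS0 hS

/-- **The pending part of the derivative state against a kernel read at the sites** (`a_K > 0`, `1 < a_v ≤ 2`, source `x′` of height `≥ θL^k` above
every face level): with the pending density `S_i ≤ 𝔪(c_S, a_v − 1)(·,x′)` on the faces `F_i ⊆ {u_{ν_i} = c_i}` read through the current differentiated
column `𝔪(c₁,1)(z,·)`, `Σ_z K(z)·[Σ_iΣ_{u∈F_i}𝔪(c₁,1;δ)(z,u)S_i(u)] ≤ n_F·𝔪(c_Kc₁c_S·K_P^far(a_K, a_v−1), a_K + (a_v−1); δ/4)(p,x′)` — §2 face by face.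
[cite: Balaban1983Higgs3, (1.16) p.414, (2.6) p.424, (2.10) p.426, p.433] -/
theorem pair_pend_site_le_far (haK : 0 < aK) (hav1 : 1 < av) (hav2 : av ≤ 2) :
    ∑ z : HiggsLattice.Site P 0, K z * ∑ i : Fin nF, ∑ u ∈ F i, maj P k c₁ 1 δ z u * S i u
      ≤ (nF : ℝ) * maj P k (cK * c₁ * cS * pendKfar P N δ aK (av - 1) θ) (aK + (av - 1)) (δ / 2 / 2) p x' := by
  have hs0 : 0 < av - 1 := by linarith
  have hs1 : av - 1 ≤ 1 := by linarith
  -- one face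
  have hface : ∀ i : Fin nF, ∑ z : HiggsLattice.Site P 0, K z * ∑ u ∈ F i, maj P k c₁ 1 δ z u * S i u
      ≤ maj P k (cK * c₁ * cS * pendKfar P N δ aK (av - 1) θ) (aK + (av - 1)) (δ / 2 / 2) p x' := by
    intro i
    have hin0 : ∀ z, 0 ≤ ∑ u ∈ F i, maj P k c₁ 1 δ z u * S i u :=
      fun z => Finset.sum_nonneg fun u hu => mul_nonneg (maj_nonneg hc₁ z u) (hS0 i u hu)
    calc ∑ z : HiggsLattice.Site P 0, K z * ∑ u ∈ F i, maj P k c₁ 1 δ z u * S i u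
        ≤ ∑ z : HiggsLattice.Site P 0, maj P k cK aK δ p z * ∑ u ∈ F i, maj P k c₁ 1 δ z u * S i u :=
          Finset.sum_le_sum fun z _ => mul_le_mul_of_nonneg_right (hK z) (hin0 z)
      _ ≤ _ := sum_maj_face_pending_le_far (P := P) (N := N) hL hδ hδ1 haK hs0 hs1 hcK hc₁ hcS hθ i₀ (hF i) p x' (hfar i)
            (S i) (hS0 i) (hS i)
  calc ∑ z : HiggsLattice.Site P 0, K z * ∑ i : Fin nF, ∑ u ∈ F i, maj P k c₁ 1 δ z u * S i u
      = ∑ i : Fin nF, ∑ z : HiggsLattice.Site P 0, K z * ∑ u ∈ F i, maj P k c₁ 1 δ z u * S i u := by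
        rw [Finset.sum_comm]; exact Finset.sum_congr rfl fun z _ => Finset.mul_sum _ _ _
    _ ≤ ∑ _i : Fin nF, maj P k (cK * c₁ * cS * pendKfar P N δ aK (av - 1) θ) (aK + (av - 1)) (δ / 2 / 2) p x' :=
        Finset.sum_le_sum fun i _ => hface i
    _ = _ := by rw [Finset.sum_const, Finset.card_univ, Fintype.card_fin, nsmul_eq_mul]

/-- **The pending part against the kernel read at the bond BASE**: `Σ_b[Σ_iΣ_{u∈F_i}𝔪(c₁,1)(b₋,u)S_i(u)]·K(b₋) ≤ d·n_F·𝔪(c_Kc₁c_SK_P^far, a_K+(a_v−1); δ/4)(p,x′)`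
(bonds = sites × directions). [cite: Balaban1983Higgs3, (1.16) p.414, (2.10) p.426] [cite: Balaban1982Higgs1, (1.4) p.604] -/
theorem pair_pend_src_le_far (haK : 0 < aK) (hav1 : 1 < av) (hav2 : av ≤ 2) :
    ∑ b : HiggsLattice.PBond P 0, (∑ i : Fin nF, ∑ u ∈ F i, maj P k c₁ 1 δ b.src u * S i u) * K b.src
      ≤ (P.d : ℝ) * ((nF : ℝ) * maj P k (cK * c₁ * cS * pendKfar P N δ aK (av - 1) θ) (aK + (av - 1)) (δ / 2 / 2) p x') := by
  have h := pair_pend_site_le_far hL hδ hδ1 hcK hcS hc₁ hθ i₀ p x' F ν c hF hfar K hK S hS0 hS haK hav1 hav2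
  have hsd := sum_site_dir (P := P) (k := 0)
    (fun z (_μ : Fin P.d) => (∑ i : Fin nF, ∑ u ∈ F i, maj P k c₁ 1 δ z u * S i u) * K z)
  rw [← hsd]
  simp only [Finset.sum_const, Finset.card_univ, Fintype.card_fin, nsmul_eq_mul]
  rw [← Finset.mul_sum]
  refine mul_le_mul_of_nonneg_left ?_ (Nat.cast_nonneg _)
  simpa only [mul_comm] using h

/-- **The pending part against the kernel read at the bond HEAD** (one lattice step: a factor `e` on `c_K`).
[cite: Balaban1983Higgs3, (1.16) p.414, (2.10) p.426] [cite: Balaban1982Higgs1, (1.4) p.604] -/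
theorem pair_pend_tgt_le_far (haK : 0 < aK) (hav1 : 1 < av) (hav2 : av ≤ 2) :
    ∑ b : HiggsLattice.PBond P 0, (∑ i : Fin nF, ∑ u ∈ F i, maj P k c₁ 1 δ b.src u * S i u) * K b.tgt
      ≤ (P.d : ℝ) * ((nF : ℝ) *
          maj P k (Real.exp 1 * cK * c₁ * cS * pendKfar P N δ aK (av - 1) θ) (aK + (av - 1)) (δ / 2 / 2) p x') := by
  have hsd := sum_site_dir (P := P) (k := 0)
    (fun z (μ : Fin P.d) => (∑ i : Fin nF, ∑ u ∈ F i, maj P k c₁ 1 δ z u * S i u) * K (z.shift μ))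
  have hb : ∑ b : HiggsLattice.PBond P 0, (∑ i : Fin nF, ∑ u ∈ F i, maj P k c₁ 1 δ b.src u * S i u) * K b.tgt
      = ∑ z : HiggsLattice.Site P 0, ∑ μ : Fin P.d, (∑ i : Fin nF, ∑ u ∈ F i, maj P k c₁ 1 δ z u * S i u) * K (z.shift μ) := by
    rw [hsd]; rfl
  rw [hb, Finset.sum_comm]
  have hμ : ∀ μ : Fin P.d, ∑ z : HiggsLattice.Site P 0, (∑ i : Fin nF, ∑ u ∈ F i, maj P k c₁ 1 δ z u * S i u) * K (z.shift μ)
      ≤ (nF : ℝ) * maj P k (Real.exp 1 * cK * c₁ * cS * pendKfar P N δ aK (av - 1) θ) (aK + (av - 1)) (δ / 2 / 2) p x' := by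
    intro μ
    have h := pair_pend_site_le_far hL hδ hδ1 (mul_nonneg (Real.exp_nonneg _) hcK) hcS hc₁ hθ i₀ p x' F ν c hF hfar
      (fun z => K (z.shift μ)) (fun z => (hK (z.shift μ)).trans (maj_shift_right hδ hδ1 hcK p z μ)) S hS0 hS haK hav1 hav2
    simpa only [mul_comm] using h
  calc ∑ μ : Fin P.d, ∑ z : HiggsLattice.Site P 0, (∑ i : Fin nF, ∑ u ∈ F i, maj P k c₁ 1 δ z u * S i u) * K (z.shift μ)
      ≤ ∑ _μ : Fin P.d, (nF : ℝ) * maj P k (Real.exp 1 * cK * c₁ * cS * pendKfar P N δ aK (av - 1) θ) (aK + (av - 1)) (δ / 2 / 2) p x' :=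
        Finset.sum_le_sum fun μ _ => hμ μ
    _ = _ := by rw [Finset.sum_const, Finset.card_univ, Fintype.card_fin, nsmul_eq_mul]

end Pairings

/-! ## §4 The three-slot rows for `1 < a_v ≤ 2` with a far-anchored sheet -/

section StepBox

/-- the constant of the derivative-column step with a far-anchored sheet: `stepC` plus the two pending pairings of §3.
[cite: Balaban1983Higgs3, (1.16) p.414, (2.10) p.426] -/
def stepBoxCfar (P : HiggsLattice.Params) (N : ℕ) (k nF : ℕ) (δ aK av cK cv cd cS c₁ κ₁ κ₂ κ₃ κ₄ θ : ℝ) : ℝ :=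
  stepC P N k δ aK av cK cv cd κ₁ κ₂ κ₃ κ₄
    + (P.d : ℝ) * ((nF : ℝ) * (κ₁ * ((Real.exp 1 * cK * c₁ * cS + cK * c₁ * cS) * pendKfar P N δ aK (av - 1) θ)))

/-- `stepBoxCfar ≥ 0` (`a_K > 0`, `a_v > 1`, `θ > 0`, constants `≥ 0`). [cite: Balaban1983Higgs3, (2.10) p.426] -/
theorem stepBoxCfar_nonneg (hL : 1 < P.L) (k nF : ℕ) {δ aK av cK cv cd cS c₁ κ₁ κ₂ κ₃ κ₄ θ : ℝ} (hδ : 0 < δ) (haK : 0 < aK)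
    (hav : 1 < av) (hcK : 0 ≤ cK) (hcv : 0 ≤ cv) (hcd : 0 ≤ cd) (hcS : 0 ≤ cS) (hc₁ : 0 ≤ c₁) (hκ₁ : 0 ≤ κ₁) (hκ₂ : 0 ≤ κ₂)
    (hκ₃ : 0 ≤ κ₃) (hκ₄ : 0 ≤ κ₄) (hθ : 0 < θ) : 0 ≤ stepBoxCfar P N k nF δ aK av cK cv cd cS c₁ κ₁ κ₂ κ₃ κ₄ θ := by
  have h1 := stepC_nonneg hL k (N := N) (κ₁ := κ₁) (κ₂ := κ₂) (κ₃ := κ₃) (κ₄ := κ₄) hδ haK hav hcK hcv hcd hκ₁ hκ₂ hκ₃ hκ₄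
  have h2 : 0 ≤ pendKfar P N δ aK (av - 1) θ := pendKfar_nonneg hL hδ haK hθ
  have he := Real.exp_nonneg (1 : ℝ)
  unfold stepBoxCfar
  positivity

/-- **ONE STEP ON A BOX, ANY COLUMN, VALUE EXPONENT `1 < a_v ≤ 2`, FAR-ANCHORED SHEET.**  Hypotheses: the kernel `K ≥ 0` of the row majorised with
exponent `a_K > 0` from the evaluation point `p`; the three-component state of `w` anchored at the source `x′` — values `V ≤ 𝔪(c_v, a_v)`,
derivatives `D(b) ≤ 𝔪(c_d, a_v − 1)(b₋,x′) + Σ_iΣ_{u∈F_i}𝔪(c₁,1)(b₋,u)·S_i(u)` with the pending sheets `S_i ≤ 𝔪(c_S, a_v − 1)(·,x′)` on the faces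
`F_i ⊆ {u_{ν_i} = c_i}`; AND the source `x′` of height `≥ θL^k` above every face level.  Conclusion: the bulk three-slot row
`Σ_b[κ₁D(b)K(b₊) + (κ₂V(b₋) + κ₁D(b))K(b₋) + κ₃V(b₊)K(b₊)] + κ₄·Σ_zK(z)L^{−kd}Σ_{u∈B^k(z̄)}V(u) ≤ 𝔪_k(stepBoxCfar, a_K + a_v − 1; δ/(4L))(p,x′)` — the
torus step `row_step_le` for the regular part plus §3 for the pending part, at the SAME exponent and rate as `B3Op116MajorantStepBox.row_step_box_deriv_le`.
[cite: Balaban1983Higgs3, (1.16) p.414, (2.6) p.424, (2.10) p.426, p.433] [cite: Balaban1982Higgs1, (3.16) p.615] -/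
theorem row_step_box_deriv_le_far (hL : 1 < P.L) {k : ℕ} (hk : 1 ≤ k) (hkK : k ≤ P.K) {δ : ℝ} (hδ : 0 < δ) (hδ1 : δ ≤ 1)
    {aK av cK cv cd cS c₁ κ₁ κ₂ κ₃ κ₄ θ : ℝ} (haK : 0 < aK) (hav1 : 1 < av) (hav2 : av ≤ 2) (hcK : 0 ≤ cK) (hcv : 0 ≤ cv) (hcd : 0 ≤ cd)
    (hcS : 0 ≤ cS) (hc₁ : 0 ≤ c₁) (hκ₁ : 0 ≤ κ₁) (hκ₂ : 0 ≤ κ₂) (hκ₃ : 0 ≤ κ₃) (hκ₄ : 0 ≤ κ₄) (hθ : 0 < θ)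
    (i₀ : Ix N) (p x' : HiggsLattice.Site P 0)
    {nF : ℕ} (F : Fin nF → Finset (HiggsLattice.Site P 0)) (ν : Fin nF → Fin P.d)
    (c : (i : Fin nF) → ZMod (P.sitesPerDir 0 (ν i))) (hF : ∀ i, ∀ u ∈ F i, u (ν i) = c i)
    (hfar : ∀ i, θ * (P.L : ℝ) ^ k ≤ ((min (x' (ν i) - c i).val (c i - x' (ν i)).val : ℕ) : ℝ))
    (K : HiggsLattice.Site P 0 → ℝ) (hK0 : ∀ y, 0 ≤ K y) (hK : ∀ y, K y ≤ maj P k cK aK δ p y)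
    (Vf : HiggsLattice.Site P 0 → ℝ) (hV0 : ∀ y, 0 ≤ Vf y) (hV : ∀ y, Vf y ≤ maj P k cv av δ y x')
    (S : Fin nF → HiggsLattice.Site P 0 → ℝ) (hS0 : ∀ i, ∀ u ∈ F i, 0 ≤ S i u)
    (hS : ∀ i, ∀ u ∈ F i, S i u ≤ maj P k cS (av - 1) δ u x')
    (Df : HiggsLattice.PBond P 0 → ℝ)
    (hD : ∀ b, Df b ≤ maj P k cd (av - 1) δ b.src x' + ∑ i : Fin nF, ∑ u ∈ F i, maj P k c₁ 1 δ b.src u * S i u) :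
    (∑ b : HiggsLattice.PBond P 0,
        (κ₁ * Df b * K b.tgt + (κ₂ * Vf b.src + κ₁ * Df b) * K b.src + κ₃ * Vf b.tgt * K b.tgt))
      + κ₄ * ∑ z : HiggsLattice.Site P 0, K z * (((P.L : ℝ) ^ (k * P.d))⁻¹ * ∑ u ∈ blockK k (blockIter k z), Vf u)
      ≤ maj P k (stepBoxCfar P N k nF δ aK av cK cv cd cS c₁ κ₁ κ₂ κ₃ κ₄ θ) (aK + av - 1) (δ / 2 / P.L / 2) p x' := by
  have hL1 : (1 : ℝ) < (P.L : ℝ) := by exact_mod_cast hL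
  have hL0 : (0 : ℝ) < (P.L : ℝ) := by linarith
  -- the two parts of the derivative state
  set D₁ : HiggsLattice.PBond P 0 → ℝ := fun b => maj P k cd (av - 1) δ b.src x' with hD₁
  set D₂ : HiggsLattice.PBond P 0 → ℝ := fun b => ∑ i : Fin nF, ∑ u ∈ F i, maj P k c₁ 1 δ b.src u * S i u with hD₂
  have hD₁0 : ∀ b, 0 ≤ D₁ b := fun b => maj_nonneg hcd _ _
  have hD₂0 : ∀ b, 0 ≤ D₂ b := fun b =>
    Finset.sum_nonneg fun i _ => Finset.sum_nonneg fun u hu => mul_nonneg (maj_nonneg hc₁ _ _) (hS0 i u hu)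
  have hD12 : ∀ b, Df b ≤ D₁ b + D₂ b := hD
  -- split the row: the regular part is the torus row with `D₁`, the pending part is `κ₁Σ D₂ (K₊ + K₋)`
  have hsplit : ∑ b : HiggsLattice.PBond P 0,
        (κ₁ * Df b * K b.tgt + (κ₂ * Vf b.src + κ₁ * Df b) * K b.src + κ₃ * Vf b.tgt * K b.tgt)
      ≤ (∑ b : HiggsLattice.PBond P 0,
          (κ₁ * D₁ b * K b.tgt + (κ₂ * Vf b.src + κ₁ * D₁ b) * K b.src + κ₃ * Vf b.tgt * K b.tgt))
        + κ₁ * ∑ b : HiggsLattice.PBond P 0, D₂ b * K b.tgt + κ₁ * ∑ b : HiggsLattice.PBond P 0, D₂ b * K b.src := by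
    rw [Finset.mul_sum, Finset.mul_sum, ← Finset.sum_add_distrib, ← Finset.sum_add_distrib]
    refine Finset.sum_le_sum fun b _ => ?_
    have h1 : κ₁ * Df b * K b.tgt ≤ κ₁ * (D₁ b + D₂ b) * K b.tgt :=
      mul_le_mul_of_nonneg_right (mul_le_mul_of_nonneg_left (hD12 b) hκ₁) (hK0 _)
    have h2 : κ₁ * Df b * K b.src ≤ κ₁ * (D₁ b + D₂ b) * K b.src :=
      mul_le_mul_of_nonneg_right (mul_le_mul_of_nonneg_left (hD12 b) hκ₁) (hK0 _)
    nlinarith [h1, h2]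
  -- the regular part: the torus step
  have hreg := row_step_le hL hk hkK hδ hδ1 haK hav1 hcK hcv hcd hκ₁ hκ₂ hκ₃ hκ₄ i₀ p x' K hK0 hK Vf hV0 hV D₁ hD₁0 (fun b => le_rfl)
  -- the pending parts
  have hrate : δ / 2 / P.L / 2 ≤ δ / 2 / 2 :=
    div_le_div_of_nonneg_right (div_le_self (by positivity) hL1.le) (by norm_num)
  have hps := pair_pend_src_le_far hL hδ hδ1 hcK hcS hc₁ hθ i₀ p x' F ν c hF hfar K hK S hS0 hS haK hav1 hav2
  have hpt := pair_pend_tgt_le_far hL hδ hδ1 hcK hcS hc₁ hθ i₀ p x' F ν c hF hfar K hK S hS0 hS haK hav1 hav2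
  have hpk : 0 ≤ pendKfar P N δ aK (av - 1) θ := pendKfar_nonneg hL hδ haK hθ
  have tS : κ₁ * ∑ b : HiggsLattice.PBond P 0, D₂ b * K b.src
      ≤ maj P k ((P.d : ℝ) * ((nF : ℝ) * (κ₁ * (cK * c₁ * cS * pendKfar P N δ aK (av - 1) θ)))) (aK + av - 1) (δ / 2 / P.L / 2) p x' := by
    have hc : 0 ≤ cK * c₁ * cS * pendKfar P N δ aK (av - 1) θ := by positivity
    have h1 : maj P k (cK * c₁ * cS * pendKfar P N δ aK (av - 1) θ) (aK + (av - 1)) (δ / 2 / 2) p x'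
        ≤ maj P k (cK * c₁ * cS * pendKfar P N δ aK (av - 1) θ) (aK + av - 1) (δ / 2 / P.L / 2) p x' := by
      rw [show aK + (av - 1) = aK + av - 1 by ring]; exact maj_rate_mono hc hrate p x'
    refine (mul_le_mul_of_nonneg_left (hps.trans (mul_le_mul_of_nonneg_left (mul_le_mul_of_nonneg_left h1 (Nat.cast_nonneg _))
      (Nat.cast_nonneg _))) hκ₁).trans (le_of_eq ?_)
    rw [mul_maj, mul_maj, mul_maj]; ring_nf
  have tT : κ₁ * ∑ b : HiggsLattice.PBond P 0, D₂ b * K b.tgt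
      ≤ maj P k ((P.d : ℝ) * ((nF : ℝ) * (κ₁ * (Real.exp 1 * cK * c₁ * cS * pendKfar P N δ aK (av - 1) θ)))) (aK + av - 1)
          (δ / 2 / P.L / 2) p x' := by
    have hc : 0 ≤ Real.exp 1 * cK * c₁ * cS * pendKfar P N δ aK (av - 1) θ := by positivity
    have h1 : maj P k (Real.exp 1 * cK * c₁ * cS * pendKfar P N δ aK (av - 1) θ) (aK + (av - 1)) (δ / 2 / 2) p x'
        ≤ maj P k (Real.exp 1 * cK * c₁ * cS * pendKfar P N δ aK (av - 1) θ) (aK + av - 1) (δ / 2 / P.L / 2) p x' := by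
      rw [show aK + (av - 1) = aK + av - 1 by ring]; exact maj_rate_mono hc hrate p x'
    refine (mul_le_mul_of_nonneg_left (hpt.trans (mul_le_mul_of_nonneg_left (mul_le_mul_of_nonneg_left h1 (Nat.cast_nonneg _))
      (Nat.cast_nonneg _))) hκ₁).trans (le_of_eq ?_)
    rw [mul_maj, mul_maj, mul_maj]; ring_nf
  -- assemble
  have hfin := add_le_add (add_le_add hreg tT) tS
  refine le_trans (by linarith [hsplit]) (hfin.trans (le_of_eq ?_))
  simp only [maj_add]
  unfold stepBoxCfar
  ring_nf

/-- the constant of the VALUE-column step with a far-anchored sheet: `stepBoxCfar` plus the resolved face charges.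
[cite: Balaban1983Higgs3, (1.16) p.414, (2.10) p.426] -/
def stepBoxVCfar (P : HiggsLattice.Params) (N : ℕ) (k nF : ℕ) (δ aK av cK cv cd cS c₁ κ₁ κ₂ κ₃ κ₄ κF θ : ℝ) : ℝ :=
  stepBoxCfar P N k nF δ aK av cK cv cd cS c₁ κ₁ κ₂ κ₃ κ₄ θ + (nF : ℝ) * (κF * (cK * cv * faceK P δ aK av))

/-- `stepBoxVCfar ≥ 0` (`a_K > 1`, `a_v > 1`, `θ > 0`, constants `≥ 0`). [cite: Balaban1983Higgs3, (2.10) p.426] -/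
theorem stepBoxVCfar_nonneg (hL : 1 < P.L) (k nF : ℕ) {δ aK av cK cv cd cS c₁ κ₁ κ₂ κ₃ κ₄ κF θ : ℝ} (hδ : 0 < δ) (haK : 1 < aK)
    (hav : 1 < av) (hcK : 0 ≤ cK) (hcv : 0 ≤ cv) (hcd : 0 ≤ cd) (hcS : 0 ≤ cS) (hc₁ : 0 ≤ c₁) (hκ₁ : 0 ≤ κ₁) (hκ₂ : 0 ≤ κ₂)
    (hκ₃ : 0 ≤ κ₃) (hκ₄ : 0 ≤ κ₄) (hκF : 0 ≤ κF) (hθ : 0 < θ) : 0 ≤ stepBoxVCfar P N k nF δ aK av cK cv cd cS c₁ κ₁ κ₂ κ₃ κ₄ κF θ := by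
  have h1 := stepBoxCfar_nonneg hL k nF (N := N) (κ₂ := κ₂) (κ₃ := κ₃) (κ₄ := κ₄) hδ (show (0:ℝ) < aK by linarith) hav hcK hcv hcd hcS hc₁
    hκ₁ hκ₂ hκ₃ hκ₄ hθ
  have h2 := faceK_nonneg hL hδ haK hav
  unfold stepBoxVCfar; positivity

/-- **ONE STEP ON A BOX, VALUE COLUMN (`a_K > 1`), VALUE EXPONENT `1 < a_v ≤ 2`, FAR-ANCHORED SHEET**: the bulk three-slot row, the block-averaged
charges AND this step's face charges `κ_F·Σ_iΣ_{y∈F_i}V(y)K(y)` (`B3Op116MajorantStepBox.pair_face_le`, exponents `a_K, a_v > 1`) against the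
three-component state with the source far from every face: `… ≤ 𝔪_k(stepBoxVCfar, a_K + a_v − 1; δ/(4L))(p,x′)`.
[cite: Balaban1983Higgs3, (1.16) p.414, (2.6) p.424, (2.10) p.426, p.433] [cite: Balaban1982Higgs1, (3.16) p.615] -/
theorem row_step_box_le_far (hL : 1 < P.L) {k : ℕ} (hk : 1 ≤ k) (hkK : k ≤ P.K) {δ : ℝ} (hδ : 0 < δ) (hδ1 : δ ≤ 1)
    {aK av cK cv cd cS c₁ κ₁ κ₂ κ₃ κ₄ κF θ : ℝ} (haK : 1 < aK) (hav1 : 1 < av) (hav2 : av ≤ 2) (hcK : 0 ≤ cK) (hcv : 0 ≤ cv)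
    (hcd : 0 ≤ cd) (hcS : 0 ≤ cS) (hc₁ : 0 ≤ c₁) (hκ₁ : 0 ≤ κ₁) (hκ₂ : 0 ≤ κ₂) (hκ₃ : 0 ≤ κ₃) (hκ₄ : 0 ≤ κ₄) (hκF : 0 ≤ κF)
    (hθ : 0 < θ) (i₀ : Ix N) (p x' : HiggsLattice.Site P 0)
    {nF : ℕ} (F : Fin nF → Finset (HiggsLattice.Site P 0)) (ν : Fin nF → Fin P.d)
    (c : (i : Fin nF) → ZMod (P.sitesPerDir 0 (ν i))) (hF : ∀ i, ∀ u ∈ F i, u (ν i) = c i)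
    (hfar : ∀ i, θ * (P.L : ℝ) ^ k ≤ ((min (x' (ν i) - c i).val (c i - x' (ν i)).val : ℕ) : ℝ))
    (K : HiggsLattice.Site P 0 → ℝ) (hK0 : ∀ y, 0 ≤ K y) (hK : ∀ y, K y ≤ maj P k cK aK δ p y)
    (Vf : HiggsLattice.Site P 0 → ℝ) (hV0 : ∀ y, 0 ≤ Vf y) (hV : ∀ y, Vf y ≤ maj P k cv av δ y x')
    (S : Fin nF → HiggsLattice.Site P 0 → ℝ) (hS0 : ∀ i, ∀ u ∈ F i, 0 ≤ S i u)
    (hS : ∀ i, ∀ u ∈ F i, S i u ≤ maj P k cS (av - 1) δ u x')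
    (Df : HiggsLattice.PBond P 0 → ℝ)
    (hD : ∀ b, Df b ≤ maj P k cd (av - 1) δ b.src x' + ∑ i : Fin nF, ∑ u ∈ F i, maj P k c₁ 1 δ b.src u * S i u) :
    (∑ b : HiggsLattice.PBond P 0,
        (κ₁ * Df b * K b.tgt + (κ₂ * Vf b.src + κ₁ * Df b) * K b.src + κ₃ * Vf b.tgt * K b.tgt))
      + κ₄ * ∑ z : HiggsLattice.Site P 0, K z * (((P.L : ℝ) ^ (k * P.d))⁻¹ * ∑ u ∈ blockK k (blockIter k z), Vf u)
      + κF * ∑ i : Fin nF, ∑ y ∈ F i, Vf y * K y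
      ≤ maj P k (stepBoxVCfar P N k nF δ aK av cK cv cd cS c₁ κ₁ κ₂ κ₃ κ₄ κF θ) (aK + av - 1) (δ / 2 / P.L / 2) p x' := by
  have hL1 : (1 : ℝ) < (P.L : ℝ) := by exact_mod_cast hL
  have hbulk := row_step_box_deriv_le_far hL hk hkK hδ hδ1 (by linarith) hav1 hav2 hcK hcv hcd hcS hc₁ hκ₁ hκ₂ hκ₃ hκ₄ hθ i₀ p x' F ν c hF
    hfar K hK0 hK Vf hV0 hV S hS0 hS Df hD
  have hface := pair_face_le hL hδ hδ1 hcK hcv p x' F ν c hF K hK0 hK Vf hV0 hV haK hav1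
  have hrate : δ / 2 / P.L / 2 ≤ δ / 2 := by
    rw [div_div, div_le_iff₀ (by positivity)]; nlinarith
  have hc : 0 ≤ cK * cv * faceK P δ aK av := mul_nonneg (mul_nonneg hcK hcv) (faceK_nonneg hL hδ haK hav1)
  have tF : κF * ∑ i : Fin nF, ∑ y ∈ F i, Vf y * K y
      ≤ maj P k ((nF : ℝ) * (κF * (cK * cv * faceK P δ aK av))) (aK + av - 1) (δ / 2 / P.L / 2) p x' := by
    refine (mul_le_mul_of_nonneg_left (hface.trans (mul_le_mul_of_nonneg_left (maj_rate_mono hc hrate p x') (Nat.cast_nonneg _)))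
      hκF).trans (le_of_eq ?_)
    rw [mul_maj, mul_maj]; ring_nf
  refine (add_le_add hbulk tF).trans (le_of_eq ?_)
  rw [maj_add]
  rfl

end StepBox

/-! ## §5 The located step on a `k`-block union with a far-anchored sheet: `w ↦ G_k(Ω,X)V_k^Ω(A,B)w` at value exponent `1 < a_v ≤ 2` -/

section Step

variable {C : ChargeData N} {Ω : Finset (HiggsLattice.Site P 0)} {A B X : HiggsLattice.VecField P 0} {msq a : ℝ} {k : ℕ}
  {δ₁ s δA cK2 cK1 : ℝ}

variable (hL : 1 < P.L) (hk : 1 ≤ k) (hkK : k ≤ P.K) (hmsq : 0 < msq) (hak : 0 ≤ B1.aSeq a P.L k)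
  (hΩ : ∀ x x' : HiggsLattice.Site P 0, blockIter k x = blockIter k x' → (x ∈ Ω ↔ x' ∈ Ω))
  (hcK2 : 0 ≤ cK2) (hcK1 : 0 ≤ cK1)
  (hcolX : ∀ x ∈ Ω, ∀ z ∈ Ω, ∑ i : Ix N, ‖propagatorK C Ω X msq a k (cb P N 0 (z, i)) x‖ ≤ maj P k cK2 2 δ₁ x z)
  (hdcolX : ∀ b : HiggsLattice.PBond P 0, Inside Ω b → ∀ z ∈ Ω,
    ∑ i : Ix N, ‖covDeriv C B (propagatorK C Ω X msq a k (cb P N 0 (z, i))) b‖ ≤ maj P k cK1 1 δ₁ b.src z)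
  (hδ₁1 : δ₁ ≤ 1) (hs : 0 ≤ s) (hA : ∀ b : HiggsLattice.PBond P 0, |A b| ≤ s) (hδA : 0 ≤ δA)
  (hregA : ∀ (z : HiggsLattice.Site P 0) (μ ν : Fin P.d), |A ⟨z.shift ν, μ⟩ - A ⟨z, μ⟩| ≤ δA)
  (i₀ : Ix N) (x' : HiggsLattice.Site P 0)
  {nF : ℕ} (F : Fin nF → Finset (HiggsLattice.Site P 0)) (ν : Fin nF → Fin P.d)
  (c : (i : Fin nF) → ZMod (P.sitesPerDir 0 (ν i))) (hF : ∀ i, ∀ u ∈ F i, u (ν i) = c i)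
  (hexF : ∀ b ∈ exB Ω A, ∃ i : Fin nF, b.src ∈ F i) (henF : ∀ b ∈ enB Ω A, ∃ i : Fin nF, b.tgt ∈ F i)
  {θ : ℝ} (hθ : 0 < θ) (hfar : ∀ i, θ * (P.L : ℝ) ^ k ≤ ((min (x' (ν i) - c i).val (c i - x' (ν i)).val : ℕ) : ℝ))
include hL hk hkK hmsq hak hΩ hcK2 hcK1 hcolX hdcolX hδ₁1 hs hA hδA hregA i₀ hF hexF henF hθ hfar

/-- **THE STEP ON A BOX, INCOMING SHEET OF EXPONENT `a_v − 1 ≤ 1`, SOURCE ONE TOP BLOCK INSIDE** (value exponent `1 < a_v ≤ 2`).  `Ω` a union of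
`k`-blocks, `m² > 0`, `a_k ≥ 0`, `1 ≤ k ≤ K`, `L > 1`; the (2.10) dictionary of `G_k(Ω,X)` on `Ω` (`κ ≤ 𝔪_k(c_{K2},2;δ₁)`, `κ^D_B ≤ 𝔪_k(c_{K1},1;δ₁)(b₋,·)`
at the bonds `⊂ Ω`), `sup|A| ≤ s`, `A` regular with `δ_A`; faces `F_i ⊆ {u_{ν_i} = c_i}` covering the legs; the source `x′` of height `≥ θL^k` above
every face level.  If `w` vanishes off `Ω`, `‖w(y)‖ ≤ 𝔪_k(c_v,a_v;δ)(y,x′)`, and at the bonds `⊂ Ω`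
`‖D^ε_Bw(b)‖ ≤ 𝔪_k(c_d,a_v−1;δ)(b₋,x′) + Σ_iΣ_{u∈F_i}𝔪_k(c_{K1},1;δ)(b₋,u)S_i(u)` with `0 ≤ S_i ≤ 𝔪_k(c_S,a_v−1;δ)(·,x′)` (`0 < δ ≤ δ₁ ≤ 1`), then
`w⁺ = G_k(Ω,X)V_k^Ω(A,B)w`: (i) vanishes off `Ω`; (ii) `‖w⁺(y)‖ ≤ 𝔪_k(stepBoxVCfar(2,a_v,…,κ_F,θ), a_v+1; δ/(4L))(y,x′)` at every `y`;
(iii) `‖D^ε_Bw⁺(b₀)‖ ≤ 𝔪_k(stepBoxCfar(1,a_v,…,θ), a_v; δ/(4L))(b₀₋,x′) + Σ_iΣ_{u∈F_i}𝔪_k(c_{K1},1;δ/(4L))(b₀₋,u)·κ_F‖w(u)‖` at every `b₀ ⊂ Ω`;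
(iv) the new sheet `κ_F‖w‖` is `≥ 0` and `≤ 𝔪_k(κ_Fc_v, a_v; δ/(4L))(·,x′)` — `collar_row_reduce` + §4.  The twin of
`B3Op116DKernelRegularBox.step_fields_box` below its threshold `a_v > 2`: the one step that digests the dipole seed's sheet (DESIGN-FILE4 §19).
[cite: Balaban1983Higgs3, (1.16) p.414, (2.5)–(2.6) p.424, (2.10) p.426, p.433] [cite: Balaban1982Higgs1, (3.16) p.615, (2.20) p.610] -/
theorem step_fields_box_far {δ cv cd cS av : ℝ} (hδ : 0 < δ) (hδδ₁ : δ ≤ δ₁) (hav1 : 1 < av) (hav2 : av ≤ 2) (hcv : 0 ≤ cv)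
    (hcd : 0 ≤ cd) (hcS : 0 ≤ cS)
    (w : ScalarField P 0 N) (hw : ∀ y : HiggsLattice.Site P 0, y ∉ Ω → w y = 0) (hV : ∀ y, ‖w y‖ ≤ maj P k cv av δ y x')
    (S : Fin nF → HiggsLattice.Site P 0 → ℝ) (hS0 : ∀ i u, 0 ≤ S i u) (hS : ∀ i u, S i u ≤ maj P k cS (av - 1) δ u x')
    (hD : ∀ b : HiggsLattice.PBond P 0, Inside Ω b →
      ‖covDeriv C B w b‖ ≤ maj P k cd (av - 1) δ b.src x' + ∑ i : Fin nF, ∑ u ∈ F i, maj P k cK1 1 δ b.src u * S i u) :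
    (∀ y : HiggsLattice.Site P 0, y ∉ Ω → propagatorK C Ω X msq a k (srcV C A B k Ω a w) y = 0) ∧
    (∀ y, ‖propagatorK C Ω X msq a k (srcV C A B k Ω a w) y‖
        ≤ maj P k (stepBoxVCfar P N k nF δ 2 av cK2 cv cd cS cK1 (|C.e| * s) ((P.mesh 0)⁻¹ * (|C.e| * δA)) ((|C.e| * s) ^ 2)
            (kap4 P C k a s) (kapF P C s δA) θ) (2 + av - 1) (δ / 2 / P.L / 2) y x') ∧
    (∀ b₀ : HiggsLattice.PBond P 0, Inside Ω b₀ →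
      ‖covDeriv C B (propagatorK C Ω X msq a k (srcV C A B k Ω a w)) b₀‖
        ≤ maj P k (stepBoxCfar P N k nF δ 1 av cK1 cv cd cS cK1 (|C.e| * s) ((P.mesh 0)⁻¹ * (|C.e| * δA)) ((|C.e| * s) ^ 2)
              (kap4 P C k a s) θ) (1 + av - 1) (δ / 2 / P.L / 2) b₀.src x'
          + ∑ i : Fin nF, ∑ u ∈ F i, maj P k cK1 1 (δ / 2 / P.L / 2) b₀.src u * (kapF P C s δA * ‖w u‖)) ∧
    (∀ u : HiggsLattice.Site P 0, 0 ≤ kapF P C s δA * ‖w u‖ ∧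
      kapF P C s δA * ‖w u‖ ≤ maj P k (kapF P C s δA * cv) av (δ / 2 / P.L / 2) u x') := by
  have hL1 : (1 : ℝ) < (P.L : ℝ) := by exact_mod_cast hL
  have hδ1 : δ ≤ 1 := hδδ₁.trans hδ₁1
  have hes : 0 ≤ |C.e| * s := mul_nonneg (abs_nonneg _) hs
  have hκ₂ : 0 ≤ (P.mesh 0)⁻¹ * (|C.e| * δA) := mul_nonneg (inv_nonneg.mpr (P.mesh_pos 0).le) (mul_nonneg (abs_nonneg _) hδA)
  have hκ₄ : 0 ≤ kap4 P C k a s := kap4_nonneg hs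
  have hκF : 0 ≤ kapF P C s δA := kapF_nonneg hs hδA
  have hrate : δ / 2 / P.L / 2 ≤ δ := by
    rw [div_div, div_div, div_le_iff₀ (by positivity)]; nlinarith
  set G : ScalarField P 0 N →ₗ[ℝ] ScalarField P 0 N := propagatorK C Ω X msq a k with hG
  -- the derivative majorant of the state as the `Df` of the reduction
  set Df : HiggsLattice.PBond P 0 → ℝ := fun b =>
    maj P k cd (av - 1) δ b.src x' + ∑ i : Fin nF, ∑ u ∈ F i, maj P k cK1 1 δ b.src u * S i u with hDf
  have hDf0 : ∀ b, 0 ≤ Df b := fun b => add_nonneg (maj_nonneg hcd _ _)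
    (Finset.sum_nonneg fun i _ => Finset.sum_nonneg fun u _ => mul_nonneg (maj_nonneg hcK1 _ _) (hS0 i u))
  have hDfin : ∀ b ∈ inB Ω A, ‖covDeriv C B w b‖ ≤ Df b := fun b hb => hD b (mem_inB.1 hb).1
  have hsupp := propagatorK_srcV_apply_eq_zero_of_not_mem C Ω A B a hΩ X hmsq hak w hw
  refine ⟨hsupp, fun y => ?_, fun b₀ hb₀ => ?_, fun u => ?_⟩
  · -- (ii) the value row at `y`
    by_cases hy : y ∈ Ω
    · set T : ScalarField P 0 N →ₗ[ℝ] E N := (LinearMap.proj y : ScalarField P 0 N →ₗ[ℝ] E N) ∘ₗ G with hT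
      have hT' : ∀ φ : ScalarField P 0 N, T φ = (G φ) y := fun φ => rfl
      have hTk : ∀ z : HiggsLattice.Site P 0, z ∉ Ω → ∀ v : E N, T (Pi.single z v) = 0 := fun z hz v =>
        proj_propagatorK_single_eq_zero C Ω X a hmsq hak hΩ hy hz v
      have hred := collar_row_reduce C Ω A B a hkK T hs hδA hA hregA hTk w hw Df hDf0 hDfin F hexF henF
      have hK0 : ∀ z, 0 ≤ ∑ i : Ix N, ‖T (cb P N 0 (z, i))‖ := fun z => Finset.sum_nonneg fun _ _ => norm_nonneg _
      have hK : ∀ z, ∑ i : Ix N, ‖T (cb P N 0 (z, i))‖ ≤ maj P k cK2 2 δ y z := fun z => by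
        simp only [hT', hG]
        exact (col_le_maj_all C Ω X a hmsq hak hΩ hcK2 hcolX hy z).trans (maj_rate_mono hcK2 hδδ₁ y z)
      have hstep := row_step_box_le_far (N := N) hL hk hkK hδ hδ1 (by norm_num : (1:ℝ) < 2) hav1 hav2 hcK2 hcv hcd hcS hcK1 hes hκ₂
        (sq_nonneg (|C.e| * s)) hκ₄ hκF hθ i₀ y x' F ν c hF hfar (fun z => ∑ i : Ix N, ‖T (cb P N 0 (z, i))‖) hK0 hK
        (fun z => ‖w z‖) (fun z => norm_nonneg _) hV S (fun i u _ => hS0 i u) (fun i u _ => hS i u) Df (fun b => le_rfl)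
      rw [← hT']
      exact hred.trans hstep
    · rw [hsupp y hy, norm_zero]
      exact maj_nonneg (stepBoxVCfar_nonneg hL k nF hδ (by norm_num) hav1 hcK2 hcv hcd hcS hcK1 hes hκ₂ (sq_nonneg _) hκ₄ hκF hθ) _ _
  · -- (iii) the derivative row at `b₀ ⊂ Ω`
    set T : ScalarField P 0 N →ₗ[ℝ] E N := covDerivAt C B b₀ ∘ₗ G with hT
    have hT' : ∀ φ : ScalarField P 0 N, T φ = covDeriv C B (G φ) b₀ := fun φ => rfl
    have hTk : ∀ z : HiggsLattice.Site P 0, z ∉ Ω → ∀ v : E N, T (Pi.single z v) = 0 := fun z hz v =>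
      covDerivAt_propagatorK_single_eq_zero C Ω X a hmsq hak hΩ B hb₀ hz v
    have hred := collar_row_reduce C Ω A B a hkK T hs hδA hA hregA hTk w hw Df hDf0 hDfin F hexF henF
    have hK0 : ∀ z, 0 ≤ ∑ i : Ix N, ‖T (cb P N 0 (z, i))‖ := fun z => Finset.sum_nonneg fun _ _ => norm_nonneg _
    have hK1 : ∀ z, ∑ i : Ix N, ‖T (cb P N 0 (z, i))‖ ≤ maj P k cK1 1 δ₁ b₀.src z := fun z => by
      simp only [hT', hG]
      exact dcol_le_maj_all C Ω X a hmsq hak hΩ B hcK1 hdcolX hb₀ z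
    have hK : ∀ z, ∑ i : Ix N, ‖T (cb P N 0 (z, i))‖ ≤ maj P k cK1 1 δ b₀.src z := fun z =>
      (hK1 z).trans (maj_rate_mono hcK1 hδδ₁ _ z)
    have hstep := row_step_box_deriv_le_far (N := N) hL hk hkK hδ hδ1 (by norm_num : (0:ℝ) < 1) hav1 hav2 hcK1 hcv hcd hcS hcK1 hes hκ₂
      (sq_nonneg (|C.e| * s)) hκ₄ hθ i₀ b₀.src x' F ν c hF hfar (fun z => ∑ i : Ix N, ‖T (cb P N 0 (z, i))‖) hK0 hK
      (fun z => ‖w z‖) (fun z => norm_nonneg _) hV S (fun i u _ => hS0 i u) (fun i u _ => hS i u) Df (fun b => le_rfl)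
    -- the face legs of THIS row are the new sheet, read through the differentiated column at the new rate
    have hsheet : kapF P C s δA * ∑ i : Fin nF, ∑ u ∈ F i, ‖w u‖ * ∑ i' : Ix N, ‖T (cb P N 0 (u, i'))‖
        ≤ ∑ i : Fin nF, ∑ u ∈ F i, maj P k cK1 1 (δ / 2 / P.L / 2) b₀.src u * (kapF P C s δA * ‖w u‖) := by
      rw [Finset.mul_sum]
      refine Finset.sum_le_sum fun i _ => ?_
      rw [Finset.mul_sum]
      refine Finset.sum_le_sum fun u _ => ?_
      have hKu : ∑ i' : Ix N, ‖T (cb P N 0 (u, i'))‖ ≤ maj P k cK1 1 (δ / 2 / P.L / 2) b₀.src u :=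
        (hK u).trans (maj_rate_mono hcK1 hrate _ _)
      calc kapF P C s δA * (‖w u‖ * ∑ i' : Ix N, ‖T (cb P N 0 (u, i'))‖)
          ≤ kapF P C s δA * (‖w u‖ * maj P k cK1 1 (δ / 2 / P.L / 2) b₀.src u) :=
            mul_le_mul_of_nonneg_left (mul_le_mul_of_nonneg_left hKu (norm_nonneg _)) hκF
        _ = _ := by ring
    rw [← hT']
    refine hred.trans ?_
    linarith [hstep, hsheet]
  · -- (iv) the new sheet
    refine ⟨mul_nonneg hκF (norm_nonneg _), ?_⟩
    calc kapF P C s δA * ‖w u‖ ≤ kapF P C s δA * maj P k cv av δ u x' := mul_le_mul_of_nonneg_left (hV u) hκF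
      _ = maj P k (kapF P C s δA * cv) av δ u x' := mul_maj _ _ _ _ _ _ _
      _ ≤ _ := maj_rate_mono (mul_nonneg hκF hcv) hrate u x'

end Step

end Literature.MathematicalPhysics.QuantumFieldTheory.Balaban1983to89.B3Op116MajorantStepBoxFar

end
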